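import Summits.CriticalPhenomena.SAWScalingLimit.Theses.SAWSpinMonotone
import Summits.CriticalPhenomena.SAWScalingLimit.Theses.SAWDevelopingMap
import Summits.CriticalPhenomena.SAWScalingLimit.Theses.SAWDefectDecoherence
import HarnessLib

/-!
# Split glue for the crux `ObservableToSLE` (stmt-CriticalPhenomena-10472) on route `SAWSpinMonotone`

Crux-strategist seat `planner-cstrat-stmt-CriticalPhenomena-10472-b1-0` (route
`route-CriticalPhenomena-SAWSpinMonotone`), 2026-08-17.  The crux
`ObservableToSLE : HexObservableLimit → HexTight → (DCS Conjecture 1 written out)` is ONE statement in the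
three hexagonal routes that want it (`SAWSpinMonotone`, `SAWDevelopingMap` — item 10472 — and the
`Iff.rfl`-twin `SAWDefectDecoherence.ObservableToSLER`, item 14005): see the `_iff_` lemmas below, all
`Iff.rfl`.  The live line (`Cruxes/ObservableToSLE/Lines/six_class_type_ladder.lean`, skeleton r11 of
lead c5; twin r14) closes it modulo three research estimates of three different species — the weakened
anchor MACROSCOPIC SOURCE LOCALITY (`stub_macroSourceLocality`, consumed only by the landed
`ObservableToSLER.Macro.stub_macroRestrictionLimit`), SIMPLICITY of subsequential limits
(`stub_hexSimpleSubseqLimits` = item stmt-CriticalPhenomena-7148 verbatim) and renewal ABUNDANCE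
(`stub_nestedRenewalFatCoSolidR`, whose typing is still moving: r1 → r3 (p124536) → r6 → r11) — plus
provable squeeze leaves.

This file lands the glue of the corresponding ROUTE-LEVEL split of `SAWSpinMonotone.ObservableToSLE`
into three children typed over Literature vocabulary only (so the route file needs no new imports and
no child freezes the moving abundance typing):

* `MacroSourceLocality` — the weakened anchor, verbatim the live stub / the second hypothesis of
  `Macro.stub_macroRestrictionLimit`;
* `HexSimpleSubseqLimits` — verbatim item stmt-CriticalPhenomena-7148;
* `AnchoredObservableToSLE := MacroSourceLocality → HexSimpleSubseqLimits → ObservableToSLE` — the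
  ABUNDANCE half: what the live line proves modulo `stub_nestedRenewalFatCoSolidR` and its provable leaves.

The glue `observableToSLE_of_anchor_simple_rest : C₁ → C₂ → C₃ → ObservableToSLE` is modus ponens
(a deliberate trivial seam: the content is the CUT — anchor species / simplicity species / abundance
species — each separately meaningful, separately refutable and separately staffable; no child gives
the crux on its own).  Registered as a stub of the item before landing (`workitem stub-add`).

[cite: DuminilCopinSmirnov2012, Conjectures 1–2; LawlerSchrammWerner2003Restriction, Thm. 6.1]
-/

namespace Summit.CriticalPhenomena.SAWScalingLimit.Theorems.ObservableToSLE.SplitB1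

open Summit.CriticalPhenomena.SAWScalingLimit

/-! ## The crux and its hypotheses are one statement across the three wanting routes -/

/-- `SAWSpinMonotone.ObservableToSLE ↔ SAWDevelopingMap.ObservableToSLE` (definitional). -/
theorem spinMonotone_observableToSLE_iff_developingMap :
    Theses.SAWSpinMonotone.ObservableToSLE ↔ Theses.SAWDevelopingMap.ObservableToSLE := Iff.rfl

/-- `SAWSpinMonotone.ObservableToSLE ↔ SAWDefectDecoherence.ObservableToSLER` (definitional). -/
theorem spinMonotone_observableToSLE_iff_defectDecoherence :
    Theses.SAWSpinMonotone.ObservableToSLE ↔ Theses.SAWDefectDecoherence.ObservableToSLER := Iff.rfl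

/-- `SAWSpinMonotone.HexObservableLimit ↔ SAWDevelopingMap.HexObservableLimit` (definitional). -/
theorem spinMonotone_hexObservableLimit_iff_developingMap :
    Theses.SAWSpinMonotone.HexObservableLimit ↔ Theses.SAWDevelopingMap.HexObservableLimit := Iff.rfl

/-- `SAWSpinMonotone.HexObservableLimit ↔ SAWDefectDecoherence.HexObservableLimitR` (definitional). -/
theorem spinMonotone_hexObservableLimit_iff_defectDecoherence :
    Theses.SAWSpinMonotone.HexObservableLimit ↔ Theses.SAWDefectDecoherence.HexObservableLimitR :=
  Iff.rfl

/-- `SAWSpinMonotone.HexTight ↔ SAWDevelopingMap.HexTight` (definitional). -/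
theorem spinMonotone_hexTight_iff_developingMap :
    Theses.SAWSpinMonotone.HexTight ↔ Theses.SAWDevelopingMap.HexTight := Iff.rfl

/-! ## The split glue (registered stub `observableToSLE_of_anchor_simple_rest` of stmt-10472) -/

/-- **Split glue** for `SAWSpinMonotone.ObservableToSLE`:
`MacroSourceLocality → HexSimpleSubseqLimits → AnchoredObservableToSLE → ObservableToSLE`, with the three
children written out (they are rendered as route decls by the gate only after this lands; the statement
below is definitionally `C₁ → C₂ → C₃ → ObservableToSLE` for those decls).  `C₁` is verbatim the live
`stub_macroSourceLocality` (second hypothesis of `ObservableToSLER.Macro.stub_macroRestrictionLimit`),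
`C₂` verbatim item stmt-CriticalPhenomena-7148, `C₃ := C₁ → C₂ → ObservableToSLE` the abundance half.
[cite: DuminilCopinSmirnov2012, Conjectures 1–2] -/
theorem observableToSLE_of_anchor_simple_rest :
    (∀ (E : Literature.Probability.RandomPlanarGeometry.DobrushinDomain) (ρ : ℝ) (Λ : ℝ → Finset Literature.Probability.LatticeModels.HexVertex) (m₀ : ℝ → ℤ) (a : ℝ → Sym2 Literature.Probability.LatticeModels.HexVertex), 0 < ρ → E.carrier ∩ Metric.ball (E.pt 0) ρ = {z : ℂ | (E.pt 0).im < z.im} ∩ Metric.ball (E.pt 0) ρ → (∀ᶠ δ : ℝ in nhdsWithin 0 (Set.Ioi 0), Literature.Probability.RandomPlanarGeometry.SAW.hexDomainSimplyConnected (Λ δ) ∧ (Literature.Probability.LatticeModels.hexGraph.induce ((Λ δ : Finset Literature.Probability.LatticeModels.HexVertex) : Set Literature.Probability.LatticeModels.HexVertex)).Preconnected ∧ a δ ∈ Literature.Probability.RandomPlanarGeometry.SAW.hexDomainBoundary (Λ δ) ∧ (∀ v ∈ Λ δ, (δ : ℂ) * Literature.Probability.LatticeModels.hexCenter v ∈ E.carrier)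 ∧ (∀ v : Literature.Probability.LatticeModels.HexVertex, (δ : ℂ) * Literature.Probability.LatticeModels.hexCenter v ∈ Metric.ball (E.pt 0) ρ → (v ∈ Λ δ ↔ m₀ δ ≤ v.1 1))) → (∀ K : Set ℂ, IsCompact K → K ⊆ E.carrier → ∀ᶠ δ : ℝ in nhdsWithin 0 (Set.Ioi 0), ∀ v : Literature.Probability.LatticeModels.HexVertex, (δ : ℂ) * Literature.Probability.LatticeModels.hexCenter v ∈ K → v ∈ Λ δ) → Filter.Tendsto (fun δ : ℝ => (δ : ℂ) * Literature.Probability.RandomPlanarGeometry.SAW.hexMidpoint (a δ)) (nhdsWithin 0 (Set.Ioi 0)) (nhds (E.pt 0)) → ∀ ε : ℝ, 0 < ε → ∀ r : ℝ, 0 < r → ∃ t₀ : ℝ, 0 < t₀ ∧ ∀ (s : ℝ → Sym2 Literature.Probability.LatticeModels.HexVertex) (t : ℝ), t ≠ 0 → |t| < t₀ → (∀ᶠ δ : ℝ in nhdsWithin 0 (Set.Ioi 0), s δ ∈ Literature.Probability.RandomPlanarGeometry.SAW.hexDomainBoundary (Λ δ) ∧ (Literature.Probability.RandomPlanarGeometry.SAW.hexMidpoint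 (s δ)).im = (Literature.Probability.RandomPlanarGeometry.SAW.hexMidpoint (a δ)).im) → Filter.Tendsto (fun δ : ℝ => (δ : ℂ) * Literature.Probability.RandomPlanarGeometry.SAW.hexMidpoint (s δ)) (nhdsWithin 0 (Set.Ioi 0)) (nhds (E.pt 0 + t)) → ∀ᶠ δ : ℝ in nhdsWithin 0 (Set.Ioi 0), (∑ γ : Literature.Probability.RandomPlanarGeometry.SAW.HexMidEdgeSAW (Λ δ) (a δ) (s δ), if ∃ v ∈ γ.verts, r ≤ dist ((δ : ℂ) * Literature.Probability.LatticeModels.hexCenter v) ((δ : ℂ) * Literature.Probability.RandomPlanarGeometry.SAW.hexMidpoint (a δ)) then Literature.Probability.RandomPlanarGeometry.SAW.hexCriticalFugacity ^ γ.length else 0) ≤ ε * ∑ γ : Literature.Probability.RandomPlanarGeometry.SAW.HexMidEdgeSAW (Λ δ) (a δ) (s δ), Literature.Probability.RandomPlanarGeometry.SAW.hexCriticalFugacity ^ γ.length) → (∀ (D : Literature.Probability.RandomPlanarGeometry.DobrushinDomain) (a b : ℝ → Literature.Probability.LatticeModels.HexVertex), Literature.Probability.RandomPlanarGeometry.SAW.IsEmbEndpointApprox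 Literature.Probability.LatticeModels.hexGraph Literature.Probability.LatticeModels.hexCenter D a b → ∀ (s : ℕ → ℝ) (ν : MeasureTheory.Measure (Literature.Probability.RandomPlanarGeometry.CurveClass ℂ)), Filter.Tendsto s Filter.atTop (nhdsWithin 0 (Set.Ioi 0)) → MeasureTheory.IsProbabilityMeasure ν → (∀ f : BoundedContinuousFunction (Literature.Probability.RandomPlanarGeometry.CurveClass ℂ) ℝ, Filter.Tendsto (fun n => ∫ γ, f γ.curve ∂(Literature.Probability.RandomPlanarGeometry.SAW.hexSAWLaw D.carrier (s n) (a (s n)) (b (s n)))) Filter.atTop (nhds (∫ x, f x ∂ν))) → ∀ᵐ γ ∂ν, γ ∈ Literature.Probability.RandomPlanarGeometry.CurveClass.simple ∧ γ.source = D.pt 0 ∧ γ.target = D.pt 1 ∧ γ.range ⊆ closure D.carrier ∧ γ.range ∩ frontier D.carrier ⊆ {D.pt 0, D.pt 1}) → ((∀ (E : Literature.Probability.RandomPlanarGeometry.DobrushinDomain) (ρ : ℝ) (Λ : ℝ → Finset Literature.Probability.LatticeModels.HexVertex) (m₀ : ℝ → ℤ) (a : ℝ → Sym2 Literature.Probability.LatticeModels.HexVertex),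 0 < ρ → E.carrier ∩ Metric.ball (E.pt 0) ρ = {z : ℂ | (E.pt 0).im < z.im} ∩ Metric.ball (E.pt 0) ρ → (∀ᶠ δ : ℝ in nhdsWithin 0 (Set.Ioi 0), Literature.Probability.RandomPlanarGeometry.SAW.hexDomainSimplyConnected (Λ δ) ∧ (Literature.Probability.LatticeModels.hexGraph.induce ((Λ δ : Finset Literature.Probability.LatticeModels.HexVertex) : Set Literature.Probability.LatticeModels.HexVertex)).Preconnected ∧ a δ ∈ Literature.Probability.RandomPlanarGeometry.SAW.hexDomainBoundary (Λ δ) ∧ (∀ v ∈ Λ δ, (δ : ℂ) * Literature.Probability.LatticeModels.hexCenter v ∈ E.carrier) ∧ (∀ v : Literature.Probability.LatticeModels.HexVertex, (δ : ℂ) * Literature.Probability.LatticeModels.hexCenter v ∈ Metric.ball (E.pt 0) ρ → (v ∈ Λ δ ↔ m₀ δ ≤ v.1 1))) → (∀ K : Set ℂ, IsCompact K → K ⊆ E.carrier → ∀ᶠ δ : ℝ in nhdsWithin 0 (Set.Ioi 0), ∀ v : Literature.Probability.LatticeModels.HexVertex, (δ : ℂ) * Literature.Probability.LatticeModels.hexCenter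 v ∈ K → v ∈ Λ δ) → Filter.Tendsto (fun δ : ℝ => (δ : ℂ) * Literature.Probability.RandomPlanarGeometry.SAW.hexMidpoint (a δ)) (nhdsWithin 0 (Set.Ioi 0)) (nhds (E.pt 0)) → ∀ ε : ℝ, 0 < ε → ∀ r : ℝ, 0 < r → ∃ t₀ : ℝ, 0 < t₀ ∧ ∀ (s : ℝ → Sym2 Literature.Probability.LatticeModels.HexVertex) (t : ℝ), t ≠ 0 → |t| < t₀ → (∀ᶠ δ : ℝ in nhdsWithin 0 (Set.Ioi 0), s δ ∈ Literature.Probability.RandomPlanarGeometry.SAW.hexDomainBoundary (Λ δ) ∧ (Literature.Probability.RandomPlanarGeometry.SAW.hexMidpoint (s δ)).im = (Literature.Probability.RandomPlanarGeometry.SAW.hexMidpoint (a δ)).im) → Filter.Tendsto (fun δ : ℝ => (δ : ℂ) * Literature.Probability.RandomPlanarGeometry.SAW.hexMidpoint (s δ)) (nhdsWithin 0 (Set.Ioi 0)) (nhds (E.pt 0 + t)) → ∀ᶠ δ : ℝ in nhdsWithin 0 (Set.Ioi 0), (∑ γ : Literature.Probability.RandomPlanarGeometry.SAW.HexMidEdgeSAW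 (Λ δ) (a δ) (s δ), if ∃ v ∈ γ.verts, r ≤ dist ((δ : ℂ) * Literature.Probability.LatticeModels.hexCenter v) ((δ : ℂ) * Literature.Probability.RandomPlanarGeometry.SAW.hexMidpoint (a δ)) then Literature.Probability.RandomPlanarGeometry.SAW.hexCriticalFugacity ^ γ.length else 0) ≤ ε * ∑ γ : Literature.Probability.RandomPlanarGeometry.SAW.HexMidEdgeSAW (Λ δ) (a δ) (s δ), Literature.Probability.RandomPlanarGeometry.SAW.hexCriticalFugacity ^ γ.length) → (∀ (D : Literature.Probability.RandomPlanarGeometry.DobrushinDomain) (a b : ℝ → Literature.Probability.LatticeModels.HexVertex), Literature.Probability.RandomPlanarGeometry.SAW.IsEmbEndpointApprox Literature.Probability.LatticeModels.hexGraph Literature.Probability.LatticeModels.hexCenter D a b → ∀ (s : ℕ → ℝ) (ν : MeasureTheory.Measure (Literature.Probability.RandomPlanarGeometry.CurveClass ℂ)), Filter.Tendsto s Filter.atTop (nhdsWithin 0 (Set.Ioi 0)) → MeasureTheory.IsProbabilityMeasure ν → (∀ f : BoundedContinuousFunction (Literature.Probability.RandomPlanarGeometry.CurveClass ℂ) ℝ,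 Filter.Tendsto (fun n => ∫ γ, f γ.curve ∂(Literature.Probability.RandomPlanarGeometry.SAW.hexSAWLaw D.carrier (s n) (a (s n)) (b (s n)))) Filter.atTop (nhds (∫ x, f x ∂ν))) → ∀ᵐ γ ∂ν, γ ∈ Literature.Probability.RandomPlanarGeometry.CurveClass.simple ∧ γ.source = D.pt 0 ∧ γ.target = D.pt 1 ∧ γ.range ⊆ closure D.carrier ∧ γ.range ∩ frontier D.carrier ⊆ {D.pt 0, D.pt 1}) → Summit.CriticalPhenomena.SAWScalingLimit.Theses.SAWSpinMonotone.ObservableToSLE) → Summit.CriticalPhenomena.SAWScalingLimit.Theses.SAWSpinMonotone.ObservableToSLE :=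
  fun hM hS hR => hR hM hS

end Summit.CriticalPhenomena.SAWScalingLimit.Theorems.ObservableToSLE.SplitB1
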